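import Summits.CriticalPhenomena.PercolationContinuityZ3.Theorems.PercNearOneGluingNoHeavyLowerTailTieLocus
import Summits.CriticalPhenomena.PercolationContinuityZ3.Theorems.PercNearOneGluingNoHeavyLowerTailGuardedCIL
import Summits.CriticalPhenomena.PercolationContinuityZ3.Theorems.PercNearOneGluingNoHeavyLowerTailDeterministicBase
import Summits.CriticalPhenomena.PercolationContinuityZ3.Theorems.PercNearOneGluingNoHeavyLowerTailChampionStability
import HarnessLib

/-!
# `NoHeavyLowerTail` (stmt-CriticalPhenomena-4575) — TIE REDUCTION for champion stability (CS₂) and the guarded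
# cumulative isolation lemma (GCIL)

Support file (prover `prim-lf-8`, lemma factory "tie/glue-locus exclusion"; `--supports stmt-CriticalPhenomena-4575`).
No definitions, no named facts, no sorries.  Built on the multi-affine pushing lemmas of `…TieLocusTools`
(`TieLocus.nonneg_of_corners_of_ties`, prover `prim-hp-8`) and the one-bond decomposition `TieLocus.real_oneBond`.

`TieReduction.le_of_tied_events` packages the pushing lemma at the level of EVENTS: an inequality
`μ_w X ≤ μ_w Y` between the probabilities of two fixed events, asserted at every relay `c` maximising the
probabilities of fixed score events `F a` over `a ∈ A`, holds everywhere as soon as it holds (i) at 0/1 weights and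
(ii) at maximisers that are TIED with another relay.  Three registered statements of the crux have exactly this
shape (the plain CIL / attached-champion instances are `…TieLocus`; the worst-relay gluing (U₁) = Kozma–Nitzan
Question 7 is the companion file `…TieLocusWorstRelay`):

* `championStabilityPair_of_tied` ⇒ `stub_championStabilityPair` (CS₂: the lightness champion `c` also serves the
  two-point observer `{x, y}`), hence `noHeavyLowerTail_of_tiedChampionStabilityPair`;
* `guardedCIL_of_tied` ⇒ the guarded CIL shape of `Theorems.noHeavyLowerTail_of_guardedCIL` (scores = guarded
  lightness), hence `noHeavyLowerTail_of_tiedGuardedCIL`;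
In each case the 0/1 corner is a deterministic transitivity at the carried configuration `{e | w e = 1}`; so each
of these conjectured inequalities is EQUIVALENT to its restriction to tied extremal relays.
-/

noncomputable section

namespace Summit.CriticalPhenomena.PercolationContinuityZ3.Theorems

open MeasureTheory Set Literature.Probability.LatticeModels Literature.Probability.Percolation
open scoped Classical BigOperators

variable {n : ℕ}

namespace TieReduction

/-- **Tie reduction at the level of events.**  `A` relays, score events `F a`, target events `X, Y`, `c ∈ A`.
If `μ_w X ≤ μ_w Y` holds at every 0/1-valued `w` where `c` maximises `a ↦ μ_w (F a)` on `A`, and at every `w`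
where `c` is such a maximiser tied with some `a ∈ A`, `a ≠ c`, then it holds at every `w` where `c` is a
maximiser.  (`TieLocus.nonneg_of_corners_of_ties` with `F = μ Y − μ X`, `D x = μ(F c) − μ(F x)` on `A ∖ {c}`, all
affine in each weight by `TieLocus.real_oneBond`.) [folklore] -/
theorem le_of_tied_events (A : Finset (Fin n)) (F : Fin n → Set (BondConfig (Fin n)))
    (X Y : Set (BondConfig (Fin n))) (c : Fin n)
    (hdet : ∀ w : Sym2 (Fin n) → unitInterval, (∀ e, (w e : ℝ) = 0 ∨ (w e : ℝ) = 1) →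
      (∀ a ∈ A, (prodBernoulli w).real (F a) ≤ (prodBernoulli w).real (F c)) →
      (prodBernoulli w).real X ≤ (prodBernoulli w).real Y)
    (htie : ∀ w : Sym2 (Fin n) → unitInterval,
      (∀ a ∈ A, (prodBernoulli w).real (F a) ≤ (prodBernoulli w).real (F c)) →
      (∃ a ∈ A, a ≠ c ∧ (prodBernoulli w).real (F a) = (prodBernoulli w).real (F c)) →
      (prodBernoulli w).real X ≤ (prodBernoulli w).real Y) :
    ∀ w : Sym2 (Fin n) → unitInterval,
      (∀ a ∈ A, (prodBernoulli w).real (F a) ≤ (prodBernoulli w).real (F c)) →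
      (prodBernoulli w).real X ≤ (prodBernoulli w).real Y := by
  intro w hch
  have hchamp_of_feas : ∀ w' : Sym2 (Fin n) → unitInterval,
      (∀ x ∈ A.erase c, 0 ≤ (prodBernoulli w').real (F c) - (prodBernoulli w').real (F x)) →
      ∀ a ∈ A, (prodBernoulli w').real (F a) ≤ (prodBernoulli w').real (F c) := by
    intro w' hfeas a ha
    by_cases hac : a = c
    · rw [hac]
    · have := hfeas a (Finset.mem_erase.2 ⟨hac, ha⟩); linarith
  have key := TieLocus.nonneg_of_corners_of_ties (ι := Sym2 (Fin n)) (A.erase c)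
    (fun w => (prodBernoulli w).real Y - (prodBernoulli w).real X)
    (fun x w => (prodBernoulli w).real (F c) - (prodBernoulli w).real (F x))
    ?hF ?hD ?hc ?ht w ?hw
  case hF =>
    intro w' e
    rw [TieLocus.real_oneBond w' e Y, TieLocus.real_oneBond w' e X]
    ring
  case hD =>
    intro x _ w' e
    rw [TieLocus.real_oneBond w' e (F c), TieLocus.real_oneBond w' e (F x)]
    ring
  case hc =>
    intro w' hw' hfeas
    have := hdet w' hw' (hchamp_of_feas w' hfeas)
    linarith
  case ht =>
    intro w' hfeas htie'
    obtain ⟨x, hx, hx0⟩ := htie'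
    obtain ⟨hxc, hxA⟩ := Finset.mem_erase.1 hx
    have := htie w' (hchamp_of_feas w' hfeas) ⟨x, hxA, hxc, by linarith⟩
    linarith
  case hw =>
    intro a ha
    have := hch a (Finset.mem_of_mem_erase ha)
    linarith
  linarith

/-- For 0/1 weights, an event of probability `1` contains the carried configuration `{e | w e = 1}`. [folklore] -/
theorem detConfig_mem_of_real_eq_one (w : Sym2 (Fin n) → unitInterval)
    (hw : ∀ e, (w e : ℝ) = 0 ∨ (w e : ℝ) = 1) {E : Set (BondConfig (Fin n))}
    (hE : (prodBernoulli w).real E = 1) : {e | (w e : ℝ) = 1} ∈ E := by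
  by_contra h
  have h0 := prodBernoulli_real_eq_zero_of_detConfig_notMem w hw h
  rw [h0] at hE
  exact absurd hE (by norm_num)

/-- For 0/1 weights: if the carried configuration lies in `F z` for some `z ∈ A` and `c` maximises `a ↦ μ(F a)` on
`A`, then the carried configuration lies in `F c`. [folklore] -/
theorem detConfig_mem_of_champion (w : Sym2 (Fin n) → unitInterval)
    (hw : ∀ e, (w e : ℝ) = 0 ∨ (w e : ℝ) = 1) (A : Finset (Fin n)) (F : Fin n → Set (BondConfig (Fin n)))
    (c z : Fin n) (hz : z ∈ A) (hzF : {e | (w e : ℝ) = 1} ∈ F z)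
    (hch : ∀ a ∈ A, (prodBernoulli w).real (F a) ≤ (prodBernoulli w).real (F c)) :
    {e | (w e : ℝ) = 1} ∈ F c := by
  have hmeas : ∀ s : Set (BondConfig (Fin n)), MeasurableSet s := fun _ => MeasurableSet.of_discrete
  have h1 := prodBernoulli_real_eq_one_of_detConfig_mem w hw (hmeas _) hzF
  refine detConfig_mem_of_real_eq_one w hw (le_antisymm measureReal_le_one ?_)
  rw [← h1]; exact hch z hz

end TieReduction

open TieReduction

/-! ### CS₂ (champion stability for vertex pairs) -/

/-- **Deterministic base for CS₂.**  At the carried configuration: if `c ↮ x`, `c ↮ y` and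
`1 ≤ |π(x) ∪ π(y)| ≤ j`, pick `z ∈ π(x) ∪ π(y)`; its block lies inside `π(x) ∪ π(y)`, so `z` is light, hence the
champion `c` is light. [folklore] -/
theorem championStabilityPair_zeroOne (w : Sym2 (Fin n) → unitInterval)
    (hw : ∀ e, (w e : ℝ) = 0 ∨ (w e : ℝ) = 1) (A : Finset (Fin n)) (x y c : Fin n) (j : ℕ)
    (hch : ∀ a ∈ A, (prodBernoulli w).real {ω : BondConfig (Fin n) |
        (A.filter fun z => ω ∈ openConn a z).card ≤ j} ≤
      (prodBernoulli w).real {ω : BondConfig (Fin n) | (A.filter fun z => ω ∈ openConn c z).card ≤ j}) :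
    (prodBernoulli w).real {ω : BondConfig (Fin n) | ω ∉ openConn c x ∧ ω ∉ openConn c y ∧
        1 ≤ (A.filter fun z => ω ∈ openConn x z ∨ ω ∈ openConn y z).card ∧
        (A.filter fun z => ω ∈ openConn x z ∨ ω ∈ openConn y z).card ≤ j} ≤
      (prodBernoulli w).real {ω : BondConfig (Fin n) | ω ∉ openConn c x ∧ ω ∉ openConn c y ∧
        (A.filter fun z => ω ∈ openConn c z).card ≤ j} := by
  have hmeas : ∀ s : Set (BondConfig (Fin n)), MeasurableSet s := fun _ => MeasurableSet.of_discrete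
  set ω₀ : BondConfig (Fin n) := {e | (w e : ℝ) = 1} with hω₀
  by_cases hX : ω₀ ∈ {ω : BondConfig (Fin n) | ω ∉ openConn c x ∧ ω ∉ openConn c y ∧
        1 ≤ (A.filter fun z => ω ∈ openConn x z ∨ ω ∈ openConn y z).card ∧
        (A.filter fun z => ω ∈ openConn x z ∨ ω ∈ openConn y z).card ≤ j}
  · obtain ⟨hcx, hcy, h1, hj⟩ := hX
    obtain ⟨z, hz⟩ := Finset.card_pos.1 h1
    obtain ⟨hzA, hzxy⟩ := Finset.mem_filter.1 hz
    -- the block of `z` lies inside `π(x) ∪ π(y)`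
    have hsub : (A.filter fun u => ω₀ ∈ openConn z u) ⊆
        (A.filter fun u => ω₀ ∈ openConn x u ∨ ω₀ ∈ openConn y u) := by
      intro u hu
      obtain ⟨huA, hzu⟩ := Finset.mem_filter.1 hu
      have hzu' : (openGraph ω₀).Reachable z u := hzu
      refine Finset.mem_filter.2 ⟨huA, ?_⟩
      rcases hzxy with h | h
      · exact Or.inl (show (openGraph ω₀).Reachable x u from (show (openGraph ω₀).Reachable x z from h).trans hzu')
      · exact Or.inr (show (openGraph ω₀).Reachable y u from (show (openGraph ω₀).Reachable y z from h).trans hzu')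
    have hFz : ω₀ ∈ {ω : BondConfig (Fin n) | (A.filter fun u => ω ∈ openConn z u).card ≤ j} :=
      (Finset.card_le_card hsub).trans hj
    have hFc := detConfig_mem_of_champion w hw A
      (fun a => {ω : BondConfig (Fin n) | (A.filter fun u => ω ∈ openConn a u).card ≤ j}) c z hzA hFz hch
    have hY : ω₀ ∈ {ω : BondConfig (Fin n) | ω ∉ openConn c x ∧ ω ∉ openConn c y ∧
        (A.filter fun z => ω ∈ openConn c z).card ≤ j} := ⟨hcx, hcy, hFc⟩
    rw [prodBernoulli_real_eq_one_of_detConfig_mem w hw (hmeas _) hY]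
    exact measureReal_le_one
  · rw [prodBernoulli_real_eq_zero_of_detConfig_notMem w hw hX]
    exact measureReal_nonneg

/-- **CS₂ at tied champions implies CS₂** (`stub_championStabilityPair`). -/
theorem championStabilityPair_of_tied
    (hT : ∀ (n : ℕ) (w : Sym2 (Fin n) → unitInterval) (A : Finset (Fin n)) (x y c : Fin n) (j : ℕ),
      x ∉ A → c ∈ A →
      (∀ a ∈ A, (prodBernoulli w).real {ω : BondConfig (Fin n) |
          (A.filter fun z => ω ∈ openConn a z).card ≤ j} ≤
        (prodBernoulli w).real {ω : BondConfig (Fin n) | (A.filter fun z => ω ∈ openConn c z).card ≤ j}) →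
      (∃ a ∈ A, a ≠ c ∧ (prodBernoulli w).real {ω : BondConfig (Fin n) |
          (A.filter fun z => ω ∈ openConn a z).card ≤ j} =
        (prodBernoulli w).real {ω : BondConfig (Fin n) | (A.filter fun z => ω ∈ openConn c z).card ≤ j}) →
      (prodBernoulli w).real {ω : BondConfig (Fin n) | ω ∉ openConn c x ∧ ω ∉ openConn c y ∧
          1 ≤ (A.filter fun z => ω ∈ openConn x z ∨ ω ∈ openConn y z).card ∧
          (A.filter fun z => ω ∈ openConn x z ∨ ω ∈ openConn y z).card ≤ j} ≤
        (prodBernoulli w).real {ω : BondConfig (Fin n) | ω ∉ openConn c x ∧ ω ∉ openConn c y ∧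
          (A.filter fun z => ω ∈ openConn c z).card ≤ j}) :
    ∀ (n : ℕ) (w : Sym2 (Fin n) → unitInterval) (A : Finset (Fin n)) (x y c : Fin n) (j : ℕ), x ∉ A → c ∈ A →
      (∀ a ∈ A, (Literature.Probability.LatticeModels.prodBernoulli w).real
          {ω : Literature.Probability.Percolation.BondConfig (Fin n) |
            (A.filter fun z => ω ∈ Literature.Probability.Percolation.openConn a z).card ≤ j} ≤
        (Literature.Probability.LatticeModels.prodBernoulli w).real
          {ω : Literature.Probability.Percolation.BondConfig (Fin n) |
            (A.filter fun z => ω ∈ Literature.Probability.Percolation.openConn c z).card ≤ j}) →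
      (Literature.Probability.LatticeModels.prodBernoulli w).real
          {ω : Literature.Probability.Percolation.BondConfig (Fin n) |
            ω ∉ Literature.Probability.Percolation.openConn c x ∧
            ω ∉ Literature.Probability.Percolation.openConn c y ∧
            1 ≤ (A.filter fun z => ω ∈ Literature.Probability.Percolation.openConn x z ∨
                  ω ∈ Literature.Probability.Percolation.openConn y z).card ∧
            (A.filter fun z => ω ∈ Literature.Probability.Percolation.openConn x z ∨
                  ω ∈ Literature.Probability.Percolation.openConn y z).card ≤ j} ≤
        (Literature.Probability.LatticeModels.prodBernoulli w).real
          {ω : Literature.Probability.Percolation.BondConfig (Fin n) |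
            ω ∉ Literature.Probability.Percolation.openConn c x ∧
            ω ∉ Literature.Probability.Percolation.openConn c y ∧
            (A.filter fun z => ω ∈ Literature.Probability.Percolation.openConn c z).card ≤ j} := by
  intro n w A x y c j hx hc hch
  exact TieReduction.le_of_tied_events A
    (fun a => {ω : BondConfig (Fin n) | (A.filter fun z => ω ∈ openConn a z).card ≤ j})
    {ω : BondConfig (Fin n) | ω ∉ openConn c x ∧ ω ∉ openConn c y ∧
      1 ≤ (A.filter fun z => ω ∈ openConn x z ∨ ω ∈ openConn y z).card ∧
      (A.filter fun z => ω ∈ openConn x z ∨ ω ∈ openConn y z).card ≤ j}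
    {ω : BondConfig (Fin n) | ω ∉ openConn c x ∧ ω ∉ openConn c y ∧
      (A.filter fun z => ω ∈ openConn c z).card ≤ j} c
    (fun w' hw' hch' => championStabilityPair_zeroOne w' hw' A x y c j hch')
    (fun w' hch' htie' => hT n w' A x y c j hx hc hch' htie') w hch

/-- **CS₂ at tied champions closes the crux `NoHeavyLowerTail`** (through the landed
`noHeavyLowerTail_of_championStabilityPair`). -/
theorem noHeavyLowerTail_of_tiedChampionStabilityPair
    (hT : ∀ (n : ℕ) (w : Sym2 (Fin n) → unitInterval) (A : Finset (Fin n)) (x y c : Fin n) (j : ℕ),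
      x ∉ A → c ∈ A →
      (∀ a ∈ A, (prodBernoulli w).real {ω : BondConfig (Fin n) |
          (A.filter fun z => ω ∈ openConn a z).card ≤ j} ≤
        (prodBernoulli w).real {ω : BondConfig (Fin n) | (A.filter fun z => ω ∈ openConn c z).card ≤ j}) →
      (∃ a ∈ A, a ≠ c ∧ (prodBernoulli w).real {ω : BondConfig (Fin n) |
          (A.filter fun z => ω ∈ openConn a z).card ≤ j} =
        (prodBernoulli w).real {ω : BondConfig (Fin n) | (A.filter fun z => ω ∈ openConn c z).card ≤ j}) →
      (prodBernoulli w).real {ω : BondConfig (Fin n) | ω ∉ openConn c x ∧ ω ∉ openConn c y ∧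
          1 ≤ (A.filter fun z => ω ∈ openConn x z ∨ ω ∈ openConn y z).card ∧
          (A.filter fun z => ω ∈ openConn x z ∨ ω ∈ openConn y z).card ≤ j} ≤
        (prodBernoulli w).real {ω : BondConfig (Fin n) | ω ∉ openConn c x ∧ ω ∉ openConn c y ∧
          (A.filter fun z => ω ∈ openConn c z).card ≤ j}) :
    Summit.CriticalPhenomena.PercolationContinuityZ3.Theses.PercNearOneGluing.NoHeavyLowerTail :=
  noHeavyLowerTail_of_championStabilityPair (championStabilityPair_of_tied hT)

/-! ### GCIL (guarded cumulative isolation) -/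

/-- **Deterministic base for GCIL.**  At the carried configuration: if `1 ≤ |π(o)| ≤ j` and some cluster other than
`C(o)` holds more than `j` relays, any relay `z` of `o`'s block has the same block and the same guard, so `z` is
guarded-light; hence so is the guarded champion. [folklore] -/
theorem guardedCIL_zeroOne (w : Sym2 (Fin n) → unitInterval)
    (hw : ∀ e, (w e : ℝ) = 0 ∨ (w e : ℝ) = 1) (A : Finset (Fin n)) (o c : Fin n) (j : ℕ)
    (hch : ∀ a ∈ A, (prodBernoulli w).real
        ({ω : BondConfig (Fin n) | (A.filter fun z => ω ∈ openConn a z).card ≤ j} ∩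
          {ω | ∃ b ∈ A, ω ∉ openConn a b ∧ j < (A.filter fun z => ω ∈ openConn b z).card}) ≤
      (prodBernoulli w).real
        ({ω : BondConfig (Fin n) | (A.filter fun z => ω ∈ openConn c z).card ≤ j} ∩
          {ω | ∃ b ∈ A, ω ∉ openConn c b ∧ j < (A.filter fun z => ω ∈ openConn b z).card})) :
    (prodBernoulli w).real
        ({ω : BondConfig (Fin n) | 1 ≤ (A.filter fun z => ω ∈ openConn o z).card ∧
            (A.filter fun z => ω ∈ openConn o z).card ≤ j} ∩
          {ω | ∃ b ∈ A, ω ∉ openConn o b ∧ j < (A.filter fun z => ω ∈ openConn b z).card}) ≤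
      (prodBernoulli w).real
        ({ω : BondConfig (Fin n) | (A.filter fun z => ω ∈ openConn c z).card ≤ j} ∩
          {ω | ∃ b ∈ A, ω ∉ openConn c b ∧ j < (A.filter fun z => ω ∈ openConn b z).card}) := by
  have hmeas : ∀ s : Set (BondConfig (Fin n)), MeasurableSet s := fun _ => MeasurableSet.of_discrete
  set ω₀ : BondConfig (Fin n) := {e | (w e : ℝ) = 1} with hω₀
  by_cases hX : ω₀ ∈ ({ω : BondConfig (Fin n) | 1 ≤ (A.filter fun z => ω ∈ openConn o z).card ∧
            (A.filter fun z => ω ∈ openConn o z).card ≤ j} ∩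
          {ω | ∃ b ∈ A, ω ∉ openConn o b ∧ j < (A.filter fun z => ω ∈ openConn b z).card})
  · obtain ⟨⟨h1, hj⟩, b, hbA, hob, hbig⟩ := hX
    obtain ⟨z, hz⟩ := Finset.card_pos.1 h1
    obtain ⟨hzA, hoz⟩ := Finset.mem_filter.1 hz
    have heq := GuardedCIL.filter_eq_of_reachable A hoz
    have hFz : ω₀ ∈ ({ω : BondConfig (Fin n) | (A.filter fun u => ω ∈ openConn z u).card ≤ j} ∩
          {ω | ∃ b ∈ A, ω ∉ openConn z b ∧ j < (A.filter fun u => ω ∈ openConn b u).card}) := by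
      refine ⟨?_, b, hbA, ?_, hbig⟩
      · show (A.filter fun u => ω₀ ∈ openConn z u).card ≤ j
        rw [heq]; exact hj
      · intro hzb
        exact hob (show (openGraph ω₀).Reachable o b from
          (show (openGraph ω₀).Reachable o z from hoz).trans (show (openGraph ω₀).Reachable z b from hzb))
    have hFc := detConfig_mem_of_champion w hw A
      (fun a => {ω : BondConfig (Fin n) | (A.filter fun u => ω ∈ openConn a u).card ≤ j} ∩
          {ω | ∃ b ∈ A, ω ∉ openConn a b ∧ j < (A.filter fun u => ω ∈ openConn b u).card}) c z hzA hFz hch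
    rw [prodBernoulli_real_eq_one_of_detConfig_mem w hw (hmeas _) hFc]
    exact measureReal_le_one
  · rw [prodBernoulli_real_eq_zero_of_detConfig_notMem w hw hX]
    exact measureReal_nonneg

/-- **GCIL at tied guarded champions implies GCIL** (the hypothesis shape of
`Theorems.noHeavyLowerTail_of_guardedCIL`). -/
theorem guardedCIL_of_tied
    (hT : ∀ (n : ℕ) (w : Sym2 (Fin n) → unitInterval) (A : Finset (Fin n)) (o c : Fin n) (j : ℕ),
      o ∉ A → c ∈ A →
      (∀ a ∈ A, (prodBernoulli w).real
          ({ω : BondConfig (Fin n) | (A.filter fun z => ω ∈ openConn a z).card ≤ j} ∩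
            {ω | ∃ b ∈ A, ω ∉ openConn a b ∧ j < (A.filter fun z => ω ∈ openConn b z).card}) ≤
        (prodBernoulli w).real
          ({ω : BondConfig (Fin n) | (A.filter fun z => ω ∈ openConn c z).card ≤ j} ∩
            {ω | ∃ b ∈ A, ω ∉ openConn c b ∧ j < (A.filter fun z => ω ∈ openConn b z).card})) →
      (∃ a ∈ A, a ≠ c ∧ (prodBernoulli w).real
          ({ω : BondConfig (Fin n) | (A.filter fun z => ω ∈ openConn a z).card ≤ j} ∩
            {ω | ∃ b ∈ A, ω ∉ openConn a b ∧ j < (A.filter fun z => ω ∈ openConn b z).card}) =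
        (prodBernoulli w).real
          ({ω : BondConfig (Fin n) | (A.filter fun z => ω ∈ openConn c z).card ≤ j} ∩
            {ω | ∃ b ∈ A, ω ∉ openConn c b ∧ j < (A.filter fun z => ω ∈ openConn b z).card})) →
      (prodBernoulli w).real
          ({ω : BondConfig (Fin n) | 1 ≤ (A.filter fun z => ω ∈ openConn o z).card ∧
              (A.filter fun z => ω ∈ openConn o z).card ≤ j} ∩
            {ω | ∃ b ∈ A, ω ∉ openConn o b ∧ j < (A.filter fun z => ω ∈ openConn b z).card}) ≤
        (prodBernoulli w).real
          ({ω : BondConfig (Fin n) | (A.filter fun z => ω ∈ openConn c z).card ≤ j} ∩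
            {ω | ∃ b ∈ A, ω ∉ openConn c b ∧ j < (A.filter fun z => ω ∈ openConn b z).card})) :
    ∀ (n : ℕ) (w : Sym2 (Fin n) → unitInterval) (A : Finset (Fin n)) (o : Fin n) (j : ℕ),
      A.Nonempty → o ∉ A → ∃ a ∈ A,
        (prodBernoulli w).real
            ({ω : BondConfig (Fin n) | 1 ≤ (A.filter fun z => ω ∈ openConn o z).card ∧
                (A.filter fun z => ω ∈ openConn o z).card ≤ j} ∩
              {ω | ∃ b ∈ A, ω ∉ openConn o b ∧ j < (A.filter fun z => ω ∈ openConn b z).card}) ≤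
          (prodBernoulli w).real
            ({ω : BondConfig (Fin n) | (A.filter fun z => ω ∈ openConn a z).card ≤ j} ∩
              {ω | ∃ b ∈ A, ω ∉ openConn a b ∧ j < (A.filter fun z => ω ∈ openConn b z).card}) := by
  intro n w A o j hA ho
  let F : Fin n → Set (BondConfig (Fin n)) := fun a =>
    {ω : BondConfig (Fin n) | (A.filter fun z => ω ∈ openConn a z).card ≤ j} ∩
      {ω | ∃ b ∈ A, ω ∉ openConn a b ∧ j < (A.filter fun z => ω ∈ openConn b z).card}
  obtain ⟨c, hc, hmax⟩ := Finset.exists_max_image A (fun a => (prodBernoulli w).real (F a)) hA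
  refine ⟨c, hc, ?_⟩
  exact TieReduction.le_of_tied_events A F
    ({ω : BondConfig (Fin n) | 1 ≤ (A.filter fun z => ω ∈ openConn o z).card ∧
        (A.filter fun z => ω ∈ openConn o z).card ≤ j} ∩
      {ω | ∃ b ∈ A, ω ∉ openConn o b ∧ j < (A.filter fun z => ω ∈ openConn b z).card}) (F c) c
    (fun w' hw' hch' => guardedCIL_zeroOne w' hw' A o c j hch')
    (fun w' hch' htie' => hT n w' A o c j ho hc hch' htie') w hmax

/-- **GCIL at tied guarded champions closes the crux `NoHeavyLowerTail`.** -/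
theorem noHeavyLowerTail_of_tiedGuardedCIL
    (hT : ∀ (n : ℕ) (w : Sym2 (Fin n) → unitInterval) (A : Finset (Fin n)) (o c : Fin n) (j : ℕ),
      o ∉ A → c ∈ A →
      (∀ a ∈ A, (prodBernoulli w).real
          ({ω : BondConfig (Fin n) | (A.filter fun z => ω ∈ openConn a z).card ≤ j} ∩
            {ω | ∃ b ∈ A, ω ∉ openConn a b ∧ j < (A.filter fun z => ω ∈ openConn b z).card}) ≤
        (prodBernoulli w).real
          ({ω : BondConfig (Fin n) | (A.filter fun z => ω ∈ openConn c z).card ≤ j} ∩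
            {ω | ∃ b ∈ A, ω ∉ openConn c b ∧ j < (A.filter fun z => ω ∈ openConn b z).card})) →
      (∃ a ∈ A, a ≠ c ∧ (prodBernoulli w).real
          ({ω : BondConfig (Fin n) | (A.filter fun z => ω ∈ openConn a z).card ≤ j} ∩
            {ω | ∃ b ∈ A, ω ∉ openConn a b ∧ j < (A.filter fun z => ω ∈ openConn b z).card}) =
        (prodBernoulli w).real
          ({ω : BondConfig (Fin n) | (A.filter fun z => ω ∈ openConn c z).card ≤ j} ∩
            {ω | ∃ b ∈ A, ω ∉ openConn c b ∧ j < (A.filter fun z => ω ∈ openConn b z).card})) →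
      (prodBernoulli w).real
          ({ω : BondConfig (Fin n) | 1 ≤ (A.filter fun z => ω ∈ openConn o z).card ∧
              (A.filter fun z => ω ∈ openConn o z).card ≤ j} ∩
            {ω | ∃ b ∈ A, ω ∉ openConn o b ∧ j < (A.filter fun z => ω ∈ openConn b z).card}) ≤
        (prodBernoulli w).real
          ({ω : BondConfig (Fin n) | (A.filter fun z => ω ∈ openConn c z).card ≤ j} ∩
            {ω | ∃ b ∈ A, ω ∉ openConn c b ∧ j < (A.filter fun z => ω ∈ openConn b z).card})) :
    Summit.CriticalPhenomena.PercolationContinuityZ3.Theses.PercNearOneGluing.NoHeavyLowerTail :=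
  noHeavyLowerTail_of_guardedCIL (guardedCIL_of_tied hT)

end Summit.CriticalPhenomena.PercolationContinuityZ3.Theorems

end
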